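import Summits.Schanuel.Schanuel.Theses.DiophantineDichotomy
import Summits.Schanuel.Schanuel.Theorems.DiophantineDichotomyDefs

/-!
# Sketch — crux-ideate r1, ideator 3 (g2), crux stmt-Schanuel-6118 `EPiSimultaneousType`

First-lemma signatures for the idea card `ideal-lattice-mai-transfer`
(Cruxes/EPiSimultaneousType/Ideas/ideal-lattice-mai-transfer.md).  Statements only (`sorry`),
over Mathlib + the route file; `crux_of_boxSprindzukMAI` concludes the crux BY NAME.

Notation.  For `F : MvPolynomial (Fin 2) ℤ`:
* `boxSupport F = (deg_x F + 1)(deg_y F + 1)` — the lattice-point count of the bounding box of the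
  support (proxy for the Newton polytope; it is `d+1` on pure one-variable polynomials and `≤ (k+1)²`
  in total degree `k`);
* `natHeight F = max |coeff|`, `logHeight F = log (natHeight F + 1)`.
-/

namespace Summit.Schanuel.Schanuel.Cruxes.EPiSimultaneousType.IdealLatticeMAI

open Summit.Schanuel.Schanuel.Theses.DiophantineDichotomy

noncomputable section

/-- Lattice-point count of the bounding box of the support of a bivariate integer polynomial. -/
def boxSupport (F : MvPolynomial (Fin 2) ℤ) : ℕ :=
  (F.degreeOf 0 + 1) * (F.degreeOf 1 + 1)

/-- Naive height `max |coeff|` of a bivariate integer polynomial. -/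
def natHeight (F : MvPolynomial (Fin 2) ℤ) : ℕ :=
  F.support.sup fun m => (F.coeff m).natAbs

/-- `log (H(F) + 1)`. -/
def logHeight (F : MvPolynomial (Fin 2) ℤ) : ℝ :=
  Real.log ((natHeight F : ℝ) + 1)

/-- The pair `θ = (π, e)` as a real point (for values of integer polynomials). -/
def thetaR : Fin 2 → ℝ := ![Real.pi, Real.exp 1]

/-- **C⁺ (Transfer target).  Box–Sprindžuk measure of algebraic independence for `(π, e)`**:
one constant `C` such that every non-zero `F ∈ ℤ[x, y]` satisfies
`|F(π, e)| ≥ exp(−C · S(F)^{1+δ} · (log H(F) + (deg F + 1)^b))`, `S(F)` = box support count.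
Generic truth (Lebesgue-a.e. `θ`, Kleinbock–Margulis 1998) is exponent `S − 1`; the pure-`x`
corner (`S = deg + 1`) is Fel'dman's type estimate for `π` (known with `(1+log deg)`); the
pure-`y` corner is the degree-aspect type of `e` (known only with exponent 2). -/
def BoxSprindzukMAI (δ b : ℝ) : Prop :=
  ∃ C : ℝ, 0 < C ∧ ∀ F : MvPolynomial (Fin 2) ℤ, F ≠ 0 →
    Real.exp (-(C * ((boxSupport F : ℝ) ^ (1 + δ)) *
      (logHeight F + ((F.totalDegree : ℝ) + 1) ^ b))) ≤ |MvPolynomial.aeval thetaR F|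

/-- **First lemma (half-full ideal lattice ⇒ cheap vanishing polynomial), entangled core.**
If `γ = (γ₁, γ₂)` generates a field of degree `D` and EACH coordinate already generates it
(entangled core of card `compositum-defect-split`), each `γᵢ` being a root of a non-zero integer
polynomial of degree `≤ d` and height `≤ H`, then in every total degree `k` with
`N_k = (k+1)(k+2)/2 ≥ 2D` there is a non-zero `F ∈ ℤ[x,y]`, `deg F ≤ k`, `F(γ) = 0`, with
`log(H(F)+1) ≤ (2k (log H + d + log(d+1)) + (D/2) log N_k) / (N_k − D) + log N_k`.
Mechanism: `Λ_k = I(Z)_k ∩ ℤ^{N_k}` is a lattice of rank `≥ N_k − D` with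
`log H(Λ_k) ≤ k (log M(p₁) + log M(p₂)) + (D/2) log N_k` (Arakelov height of the Veronese row
`v_k(γ)`; equivalently `Λ_k^⊥ ⊇ {(Tr_{K/ℚ}(β γ^m))_m : β ∈ 𝔡^k 𝔇_K^{-1}}`, the discriminant
entering favourably), and the relative Siegel lemma of Bombieri–Vaaler (Bombieri–Gubler,
Heights, Thm 2.9.19, `K = ℚ`, `M = 1`) extracts a solution of height `≤ H(Λ_k)^{1/(N_k − D)}`. -/
theorem exists_cheap_vanishing_poly
    (D d H k : ℕ) (γ : Fin 2 → ℂ)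
    (hD : Module.finrank ℚ ↥(IntermediateField.adjoin ℚ (Set.range γ)) = D)
    (hent : ∀ i, Module.finrank ℚ ↥(IntermediateField.adjoin ℚ ({γ i} : Set ℂ)) = D)
    (hclause : ∀ i, ∃ P : Polynomial ℤ, P ≠ 0 ∧ P.natDegree ≤ d ∧ (∀ j, |P.coeff j| ≤ (H : ℤ)) ∧
      Polynomial.aeval (γ i) P = 0)
    (hk : 4 * D ≤ (k + 1) * (k + 2)) :
    -- no general-position hypothesis is needed: Bombieri–Vaaler's relative Siegel lemma
    -- (Bombieri–Gubler Thm 2.9.19 with K = ℚ, F = ℚ(γ), M = 1, N = N_k > D) gives N_k − D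
    -- independent integer solutions with ∏ H(x_l) ≤ N_k^{D/2} · H(1:γ₁:γ₂)^{kD}.
    ∃ F : MvPolynomial (Fin 2) ℤ, F ≠ 0 ∧ F.totalDegree ≤ k ∧ MvPolynomial.aeval γ F = 0 ∧
      logHeight F ≤ (2 * k * (Real.log H + d + Real.log (d + 1)) +
        (D : ℝ) / 2 * Real.log ((k + 1) * (k + 2) / 2 : ℝ)) / (((k + 1) * (k + 2) / 2 : ℝ) - D) +
        Real.log ((k + 1) * (k + 2) / 2 : ℝ) := by
  sorry

/-- **Elementary step (vanishing on the orbit ⇒ small at θ).**  If `F(γ) = 0` and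
`‖γ − (π, e)‖ ≤ ε ≤ 1` then `|F(π, e)| ≤ ε · N · H(F) · k · 5^k` (mean value theorem on the
segment, `N = #support`, `k = deg F`). -/
theorem abs_aeval_theta_le_of_vanishing
    (F : MvPolynomial (Fin 2) ℤ) (γ : Fin 2 → ℂ) (ε : ℝ)
    (hF : MvPolynomial.aeval γ F = 0) (hε : ‖γ - ![(Real.pi : ℂ), (Real.exp 1 : ℂ)]‖ ≤ ε)
    (hε1 : ε ≤ 1) :
    |MvPolynomial.aeval thetaR F| ≤
      ε * F.support.card * natHeight F * (F.totalDegree + 1) * 5 ^ F.totalDegree := by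
  sorry

/-- **Transfer, entangled core (the card's C⁺ ⇒ crux with `a = 1/2 + δ + o(1)` on the entangled
core).**  Stated here for the whole crux via the crude two-regime analysis of the card
(`min dᵢ ≤ D^{a'}`: pure corner of the MAI; `min dᵢ > D^{a'}`: trace-lattice bound with the
factor `D/dᵢ`), which yields some `a < 1` as soon as `δ < 1/4`. -/
theorem crux_of_boxSprindzukMAI (δ b : ℝ) (hδ : 0 < δ) (hδ' : δ < 1 / 4) (hb : 1 ≤ b)
    (h : BoxSprindzukMAI δ b) : EPiSimultaneousType := by
  sorry

/-! ### Route-level companion (not part of the card): Philippon currency for the n = 2 race.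
`EPiPhilipponType τ`: `log ‖γ − θ‖ ≥ −C (log H + d log(d+1) + 1)^τ`; for `τ < 2` it wins the race
against the route's ONE-sided `ApproximationPropertyDegOne` at `Y = Δ` (so it could replace
`EPiSimultaneousType` inside `EPiRace`), and it drops the hyper-height linear-in-`log H` wall. -/

/-- Simultaneous approximation measure for `(π, e)` in Philippon's product currency. -/
def EPiPhilipponType (τ : ℝ) : Prop :=
  ∃ C : ℝ, 0 < C ∧ ∀ (d H : ℕ) (γ : Fin 2 → ℂ),
    Module.finrank ℚ ↥(IntermediateField.adjoin ℚ (Set.range γ)) ≤ d →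
    (∀ i, ∃ P : Polynomial ℤ, P ≠ 0 ∧ P.natDegree ≤ d ∧ (∀ k, |P.coeff k| ≤ (H : ℤ)) ∧
      Polynomial.aeval (γ i) P = 0) →
    Real.exp (-(C * (Real.log H + d * Real.log (d + 1) + 1) ^ τ)) ≤
      ‖γ - ![(Real.pi : ℂ), (Real.exp 1 : ℂ)]‖

/-- The race in Philippon currency: any `τ < 2` measure plus the level-1 approximation property
AT `(π, e)` (hypothesis of `EPiRace`, implied by `ApproximationPropertyDegOne`) gives `e ⊥ π`. -/
theorem epiRace_philippon (τ : ℝ) (hτ : τ < 2) (hM : EPiPhilipponType τ)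
    (hAP : (Algebra.trdeg ℚ ↥(IntermediateField.adjoin ℚ
        (Set.range ![(Real.pi : ℂ), (Real.exp 1 : ℂ)])) ≤ (1 : Cardinal) →
      ∃ c : ℝ, 1 ≤ c ∧ ∀ Δ Y : ℝ, c ≤ Δ → Δ ≤ Y → ∃ (γ : Fin 2 → ℂ) (d H : ℕ),
        Module.finrank ℚ ↥(IntermediateField.adjoin ℚ (Set.range γ)) ≤ d ∧
        (∀ i, ∃ P : Polynomial ℤ, P ≠ 0 ∧ P.natDegree ≤ d ∧ (∀ k, |P.coeff k| ≤ (H : ℤ)) ∧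
          Polynomial.aeval (γ i) P = 0) ∧
        (d : ℝ) ≤ c * Δ ∧ Real.log H ≤ c * Y ∧
        ‖γ - ![(Real.pi : ℂ), (Real.exp 1 : ℂ)]‖ ≤ Real.exp (-((Real.log H * Δ + d * Y) / c)))) :
    AlgebraicIndependent ℚ ![Real.exp 1, Real.pi] := by
  sorry

/-! ### Bridge to the parent crux's picked line (`lw-small-height`, crux stmt-Schanuel-6116)
The vocabulary below is the tree's (`Theorems/DiophantineDichotomyDefs.lean`, namespace
`Summit.Schanuel.Schanuel.Cruxes.KhovanskiiApproxType.LwSmallHeight`).  `EPiSimultaneousType` is the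
instance `n = 2`, `s = (1, iπ)` of `KhovanskiiApproxType`; the two signatures say (i) how a pointwise
approximation type at `s = (1, iπ)` gives the crux (support, provable now: challenger
`(γ₁, γ₂) ↦ (1, iγ₁, γ₂, −1)`, field `K(i)`, integer polynomial `P₁(ix)P₁(−ix)` of degree `≤ 2d` and
height `≤ (d+1)H²` at `iγ₁`), and (ii) that the parent line's three provable stubs plus its OPEN input
stub specialised at `s = (1, iπ)` already conclude this crux — so the 6118 chain can SHARE the 6116
stubs instead of building a parallel skeleton. -/

open Summit.Schanuel.Schanuel.Cruxes.KhovanskiiApproxType.LwSmallHeight in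
/-- (i) Pointwise approximation type `a < 1` at the free Khovanskii point `s = (1, iπ)` gives the crux. -/
theorem epiSimultaneousType_of_approxTypeAt_one_ipi
    (h : ∃ a b C : ℝ, a < 1 ∧ ApproxTypeAt 2 ![(1 : ℂ), Complex.I * (Real.pi : ℂ)] a b C) :
    EPiSimultaneousType := by
  sorry

open Summit.Schanuel.Schanuel.Cruxes.KhovanskiiApproxType.LwSmallHeight in
/-- The parent line's open input stub `NonLWInputsTwo`, specialised to `s = (1, iπ)`: a pair of
coordinates of `θ = (1, iπ, e, −1)` (necessarily `(iπ, e)`) carrying a decoupled codimension-one measure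
with exponent `μ` and floors with exponent `A` at both, in the race window `A(μ+1) < 2(A+1)`. -/
def InputsAtOneIPi : Prop :=
  ∃ e : Fin 2 → Fin 2 ⊕ Fin 2, Function.Injective e ∧ ∃ μ K C A : ℝ,
    0 ≤ μ ∧ 0 ≤ K ∧ 0 < A ∧ A * (μ + 1) < 2 * (A + 1) ∧
    CodimOneMeasure 2 (Sum.elim ![(1 : ℂ), Complex.I * (Real.pi : ℂ)]
      (Complex.exp ∘ ![(1 : ℂ), Complex.I * (Real.pi : ℂ)]) ∘ e) μ K C ∧
    ∀ i, ∃ K₁ C₁ : ℝ, SlotFloor (Sum.elim ![(1 : ℂ), Complex.I * (Real.pi : ℂ)]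
      (Complex.exp ∘ ![(1 : ℂ), Complex.I * (Real.pi : ℂ)]) (e i)) A K₁ C₁

open Summit.Schanuel.Schanuel.Cruxes.KhovanskiiApproxType.LwSmallHeight in
/-- (ii) The parent line, specialised: its provable spine (`SiegelInIdeal`, the transfer, the slot
dichotomy — registered stubs of crux 6116) plus the inputs at `s = (1, iπ)` give this crux.  Pure
composition of the parent skeleton's `approxTypeAt_two_…` with (i). -/
theorem epiSimultaneousType_of_parentLine
    (h₁ : SiegelInIdeal) (h₂ : SiegelInIdeal → CodimOneTransfer) (h₃ : SlotDichotomyTwo)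
    (h₄ : InputsAtOneIPi) : EPiSimultaneousType := by
  sorry

end

end Summit.Schanuel.Schanuel.Cruxes.EPiSimultaneousType.IdealLatticeMAI
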